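import Summits.PneNP.PneNP.Theses.HeisenbergSparsestCut
import Literature.Barriers.PneNP.TSPExtensionComplexityFarkas

/-!
# Line `sos-capture-duality` for crux `NoConstantApproxSparsestCut` (stmt-PneNP-2284)

Crux-strategist (cstrat-stmt-PneNP-2284, BC2 redirect). TYPED DECOMPOSITION of the deciding crux
into two pieces that are the route's leaves:

* `stub_sosOptimal  : SosOptimalForSparsestCut`   — route item stmt-PneNP-18995 (NEW crux, rank 6):
  SOS optimality for non-uniform sparsest cut, value / rounding form (a fixed Lasserre degree matches
  any polynomial-time constant-factor approximation on every real-weighted instance);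
* `stub_lasserreGaps : LasserreCutMetricsFarFromL1` — route item stmt-PneNP-2287 (crux, rank 3):
  degree-`d` Booleanity pseudo-cut-metrics with no `D`-embedding into `ℓ₁`, for every `d`, `D`;

and the KERNEL-CHECKED composition
`NoConstantApproxSparsestCut_of : SosOptimalForSparsestCut → LasserreCutMetricsFarFromL1 → NoConstantApproxSparsestCut`
(no sorry outside the two stubs), whose content is the HARD direction of level-`d`
Linial–London–Rabinovich / Aumann–Rabani LP duality (`cutCone_alternative`, from the tree's algebraic
Farkas lemma `Literature.Barriers.PneNP.farkas`). The same proof, over the route decl names and in the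
`Summit.PneNP.PneNP.Theorems` namespace, is attached as evidence
(`HeisenbergSparsestCutNoConstantApproxSparsestCutSplit.lean`, on stmt-PneNP-19070 and stmt-PneNP-2284) for a
prover to land under `Theorems/` (planners are bounced there: perm.theorems-prover-only); it closes the route's
glue item `NoConstantApproxSparsestCutOfSubs` (stmt-PneNP-19070, route rev 5) by name. `route edit --split` is
refused outside a seat's final cycle, so the decomposition is recorded as items 18995 + 2287 + glue 19070.
-/

set_option linter.dupNamespace false

namespace Summit.PneNP.PneNP.Cruxes.NoConstantApproxSparsestCut.SosCaptureDuality

open Summit.PneNP.PneNP.Theses.HeisenbergSparsestCut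

/-- STUB 1 (= route crux stmt-PneNP-18995): SOS optimality for non-uniform sparsest cut. -/
theorem stub_sosOptimal : SosOptimalForSparsestCut := by
  sorry

/-- STUB 2 (= route crux stmt-PneNP-2287): unbounded fixed-degree Lasserre gap, metric form. -/
theorem stub_lasserreGaps : LasserreCutMetricsFarFromL1 := by
  sorry


open MvPolynomial Finset Matrix Literature.Computability.MetaComplexity

/-- **Cut-cone alternative (Linial–London–Rabinovich / Aumann–Rabani LP duality at a fixed
"metric", hard direction).** For any real `ρ` on the ordered pairs of `Fin m` and any `D`, either
`ρ` admits a map `f` into some `ℓ₁^N` with `ρ ≤ ‖f i - f j‖₁ ≤ D ρ` pointwise, or there is a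
sparsest-cut instance (capacities `cap ≥ 0`, demands `dem ≥ 0` on ordered pairs) on which every
cut has sparsity `≥ 1` (`dem(δS) ≤ cap(δS)`) while the fractional solution `ρ` has ratio `< 1/D`
(`D · Σ cap ρ < Σ dem ρ`), i.e. an integrality-ratio-`> D` instance for `ρ`. Farkas' lemma applied
to the cone generated by the cut semimetrics and the slack directions. [folklore] -/
theorem cutCone_alternative {m : ℕ} (ρ : Fin m → Fin m → ℝ) (D : ℝ) :
    (∃ (N : ℕ) (f : Fin m → Fin N → ℝ), ∀ i j : Fin m,
        ρ i j ≤ ∑ k, |f i k - f j k| ∧ ∑ k, |f i k - f j k| ≤ D * ρ i j) ∨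
    (∃ cap dem : Fin m → Fin m → ℝ, (∀ i j, 0 ≤ cap i j) ∧ (∀ i j, 0 ≤ dem i j) ∧
      (∀ S : Finset (Fin m),
        ∑ i, ∑ j, dem i j * |(if i ∈ S then (1 : ℝ) else 0) - (if j ∈ S then (1 : ℝ) else 0)| ≤
          ∑ i, ∑ j, cap i j * |(if i ∈ S then (1 : ℝ) else 0) - (if j ∈ S then (1 : ℝ) else 0)|) ∧
      D * ∑ i, ∑ j, cap i j * ρ i j < ∑ i, ∑ j, dem i j * ρ i j) := by
  classical
  -- cut indicator on ordered pairs
  let sep : Finset (Fin m) → Fin m × Fin m → ℝ :=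
    fun S p => |(if p.1 ∈ S then (1 : ℝ) else 0) - (if p.2 ∈ S then (1 : ℝ) else 0)|
  have hsep : ∀ (S : Finset (Fin m)) (i j : Fin m),
      sep S (i, j) = |(if i ∈ S then (1 : ℝ) else 0) - (if j ∈ S then (1 : ℝ) else 0)| :=
    fun S i j => rfl
  -- generators: cuts (both blocks), lower slacks `-e_p` (first block), upper slacks `+e_p` (second block)
  rcases Literature.Barriers.PneNP.farkas
      (G := Finset (Fin m) ⊕ ((Fin m × Fin m) ⊕ (Fin m × Fin m)))
      (κ := (Fin m × Fin m) ⊕ (Fin m × Fin m))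
      (Sum.elim (fun S => Sum.elim (sep S) (sep S))
        (Sum.elim (fun q => Sum.elim (fun p => if p = q then (-1 : ℝ) else 0) (fun _ => 0))
          (fun q => Sum.elim (fun _ => (0 : ℝ)) (fun p => if p = q then (1 : ℝ) else 0))))
      (Sum.elim (fun p => ρ p.1 p.2) (fun p => D * ρ p.1 p.2)) with ⟨lam, hlam, hb⟩ | ⟨y, hy, hby⟩
  · -- feasible: `ρ_p + s_p = Σ_S λ_S sep_S(p)` and `D ρ_p = Σ_S λ_S sep_S(p) + t_p`
    left
    have hlow : ∀ p : Fin m × Fin m, ρ p.1 p.2 ≤ ∑ S : Finset (Fin m), lam (Sum.inl S) * sep S p := by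
      intro p
      have h := hb (Sum.inl p)
      simp only [Sum.elim_inl, Sum.elim_inr, Fintype.sum_sum_type, mul_ite, mul_neg, mul_one,
        mul_zero, Finset.sum_ite_eq, Finset.mem_univ, if_true, Finset.sum_const_zero, add_zero] at h
      linarith [hlam (Sum.inr (Sum.inl p))]
    have hup : ∀ p : Fin m × Fin m, ∑ S : Finset (Fin m), lam (Sum.inl S) * sep S p ≤ D * ρ p.1 p.2 := by
      intro p
      have h := hb (Sum.inr p)
      simp only [Sum.elim_inl, Sum.elim_inr, Fintype.sum_sum_type, mul_ite, mul_one, mul_zero,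
        Finset.sum_ite_eq, Finset.mem_univ, if_true, Finset.sum_const_zero, zero_add] at h
      linarith [hlam (Sum.inr (Sum.inr p))]
    -- the embedding: one coordinate per cut, `f i S = λ_S · 𝟙_S(i)`
    set N : ℕ := Fintype.card (Finset (Fin m)) with hN
    let e : Finset (Fin m) ≃ Fin N := Fintype.equivFin _
    refine ⟨N, fun i k => lam (Sum.inl (e.symm k)) * (if i ∈ e.symm k then (1 : ℝ) else 0),
      fun i j => ?_⟩
    have hsum : ∑ k, |lam (Sum.inl (e.symm k)) * (if i ∈ e.symm k then (1 : ℝ) else 0) -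
          lam (Sum.inl (e.symm k)) * (if j ∈ e.symm k then (1 : ℝ) else 0)| =
        ∑ S : Finset (Fin m), lam (Sum.inl S) * sep S (i, j) := by
      calc ∑ k, |lam (Sum.inl (e.symm k)) * (if i ∈ e.symm k then (1 : ℝ) else 0) -
              lam (Sum.inl (e.symm k)) * (if j ∈ e.symm k then (1 : ℝ) else 0)|
          = ∑ k, lam (Sum.inl (e.symm k)) * sep (e.symm k) (i, j) := by
            refine Finset.sum_congr rfl fun k _ => ?_
            rw [← mul_sub, abs_mul, abs_of_nonneg (hlam _)]
        _ = ∑ S : Finset (Fin m), lam (Sum.inl S) * sep S (i, j) :=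
            e.symm.sum_comp (fun S => lam (Sum.inl S) * sep S (i, j))
    rw [hsum]
    exact ⟨hlow (i, j), hup (i, j)⟩
  · -- infeasible: the Farkas vector is a violated sparsest-cut instance
    right
    have hu : ∀ q : Fin m × Fin m, y (Sum.inl q) ≤ 0 := by
      intro q
      have h := hy (Sum.inr (Sum.inl q))
      simp only [Sum.elim_inl, Sum.elim_inr, dotProduct, Fintype.sum_sum_type, ite_mul, neg_mul,
        one_mul, zero_mul, Finset.sum_ite_eq', Finset.mem_univ, if_true, Finset.sum_const_zero,
        add_zero] at h
      linarith
    have hw : ∀ q : Fin m × Fin m, 0 ≤ y (Sum.inr q) := by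
      intro q
      have h := hy (Sum.inr (Sum.inr q))
      simp only [Sum.elim_inl, Sum.elim_inr, dotProduct, Fintype.sum_sum_type, ite_mul, one_mul,
        zero_mul, Finset.sum_ite_eq', Finset.mem_univ, if_true, Finset.sum_const_zero, zero_add] at h
      exact h
    have hcut : ∀ S : Finset (Fin m),
        0 ≤ ∑ p : Fin m × Fin m, sep S p * y (Sum.inl p) + ∑ p : Fin m × Fin m, sep S p * y (Sum.inr p) := by
      intro S
      have h := hy (Sum.inl S)
      simp only [Sum.elim_inl, Sum.elim_inr, dotProduct, Fintype.sum_sum_type] at h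
      exact h
    have hval : ∑ p : Fin m × Fin m, ρ p.1 p.2 * y (Sum.inl p) +
        ∑ p : Fin m × Fin m, D * ρ p.1 p.2 * y (Sum.inr p) < 0 := by
      have h := hby
      simp only [Sum.elim_inl, Sum.elim_inr, dotProduct, Fintype.sum_sum_type] at h
      exact h
    refine ⟨fun i j => y (Sum.inr (i, j)), fun i j => -y (Sum.inl (i, j)), fun i j => hw _,
      fun i j => by linarith [hu (i, j)], fun S => ?_, ?_⟩
    · have h := hcut S
      rw [Fintype.sum_prod_type, Fintype.sum_prod_type] at h
      simp only [hsep] at h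
      have e1 : ∑ i, ∑ j, -y (Sum.inl (i, j)) * |(if i ∈ S then (1 : ℝ) else 0) - (if j ∈ S then (1 : ℝ) else 0)|
          = -∑ i, ∑ j, |(if i ∈ S then (1 : ℝ) else 0) - (if j ∈ S then (1 : ℝ) else 0)| * y (Sum.inl (i, j)) := by
        rw [← Finset.sum_neg_distrib]
        refine Finset.sum_congr rfl fun i _ => ?_
        rw [← Finset.sum_neg_distrib]
        refine Finset.sum_congr rfl fun j _ => ?_
        ring
      have e2 : ∑ i, ∑ j, y (Sum.inr (i, j)) * |(if i ∈ S then (1 : ℝ) else 0) - (if j ∈ S then (1 : ℝ) else 0)|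
          = ∑ i, ∑ j, |(if i ∈ S then (1 : ℝ) else 0) - (if j ∈ S then (1 : ℝ) else 0)| * y (Sum.inr (i, j)) := by
        refine Finset.sum_congr rfl fun i _ => Finset.sum_congr rfl fun j _ => ?_
        ring
      rw [e1, e2]
      linarith
    · have h := hval
      rw [Fintype.sum_prod_type, Fintype.sum_prod_type] at h
      have e1 : ∑ i, ∑ j, -y (Sum.inl (i, j)) * ρ i j = -∑ i, ∑ j, ρ i j * y (Sum.inl (i, j)) := by
        rw [← Finset.sum_neg_distrib]
        refine Finset.sum_congr rfl fun i _ => ?_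
        rw [← Finset.sum_neg_distrib]
        refine Finset.sum_congr rfl fun j _ => ?_
        ring
      have e2 : D * ∑ i, ∑ j, y (Sum.inr (i, j)) * ρ i j = ∑ i, ∑ j, D * ρ i j * y (Sum.inr (i, j)) := by
        rw [Finset.mul_sum]
        refine Finset.sum_congr rfl fun i _ => ?_
        rw [Finset.mul_sum]
        refine Finset.sum_congr rfl fun j _ => ?_
        ring
      rw [e1, e2]
      linarith

/-- Degree monotonicity of pseudoexpectations: a degree-`d'` pseudoexpectation is a degree-`d`
pseudoexpectation for `d ≤ d'`. [cite: arXiv170104521, Def. 2.7] -/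
theorem isPseudoexpectation_mono {d d' : ℕ} (h : d ≤ d')
    {E : MvPolynomial ℕ ℝ →ₗ[ℝ] ℝ} (hE : IsPseudoexpectation d' E) : IsPseudoexpectation d E :=
  ⟨hE.1, fun p hp => hE.2 p (hp.trans h)⟩

/-- Degree monotonicity of identities. [cite: arXiv170104521, Def. 2.8] -/
theorem satisfiesIdentity_mono {d d' : ℕ} (h : d ≤ d')
    {E : MvPolynomial ℕ ℝ →ₗ[ℝ] ℝ} {q : MvPolynomial ℕ ℝ} (hE : SatisfiesIdentity d' E q) :
    SatisfiesIdentity d E q :=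
  fun r hr => hE r (hr.trans h)

/-- A pseudoexpectation of degree `≥ 2` is nonnegative on squares of linear forms, so its
pseudo-cut-metric `Ẽ[(x_i - x_j)²]` is nonnegative. [cite: arXiv170104521, Def. 2.7] -/
theorem pseudoCutMetric_nonneg {d : ℕ} (hd : 2 ≤ d)
    {E : MvPolynomial ℕ ℝ →ₗ[ℝ] ℝ} (hE : IsPseudoexpectation d E) (i j : ℕ) :
    0 ≤ E ((X i - X j) ^ 2) := by
  rw [pow_two]
  refine hE.2 _ (le_trans ?_ hd)
  have h1 : ((X i - X j : MvPolynomial ℕ ℝ)).totalDegree ≤ 1 :=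
    (totalDegree_sub _ _).trans (max_le (totalDegree_X (R := ℝ) i).le (totalDegree_X (R := ℝ) j).le)
  omega

/-- **Decomposition of the deciding crux (stmt-PneNP-2284).**
`SosOptimalForSparsestCut → LasserreCutMetricsFarFromL1 → NoConstantApproxSparsestCut`:
if `Gap_C ∈ PromiseP` for some `C ≥ 1`, SOS optimality gives a degree `d` and a ratio bound `D`
valid on every real-weighted instance; the Lasserre-gap crux at degree `max d 2` gives a
Booleanity pseudoexpectation on `Fin m` whose pseudo-cut-metric `ρ` has no `D`-embedding into
`ℓ₁`; by the cut-cone alternative (LP duality) there is then an instance on which every cut has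
sparsity `≥ 1` but `ρ` has ratio `< 1/D`, and the rounding guarantee at that instance produces a
cut of sparsity `< 1` — contradiction. [folklore] -/
theorem NoConstantApproxSparsestCut_of
    (h1 : Summit.PneNP.PneNP.Theses.HeisenbergSparsestCut.SosOptimalForSparsestCut)
    (h2 : Summit.PneNP.PneNP.Theses.HeisenbergSparsestCut.LasserreCutMetricsFarFromL1) :
    Summit.PneNP.PneNP.Theses.HeisenbergSparsestCut.NoConstantApproxSparsestCut := by
  unfold Summit.PneNP.PneNP.Theses.HeisenbergSparsestCut.NoConstantApproxSparsestCut
  intro C hC hmem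
  obtain ⟨d, D, hD, hround⟩ := h1 C hC hmem
  obtain ⟨m, E, hE, hBool, hne⟩ := h2 (max d 2) D
  have hEd : IsPseudoexpectation d E :=
    isPseudoexpectation_mono (le_max_left d 2) hE
  have hBoold : ∀ i : ℕ, SatisfiesIdentity d E (boolAxiom i) := fun i =>
    satisfiesIdentity_mono (le_max_left d 2) (hBool i)
  have hρ0 : ∀ i j : Fin m, 0 ≤ E ((X (i : ℕ) - X (j : ℕ)) ^ 2) := fun i j =>
    pseudoCutMetric_nonneg (le_max_right d 2) hE _ _
  rcases cutCone_alternative (fun i j : Fin m => E ((X (i : ℕ) - X (j : ℕ)) ^ 2)) D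
    with hemb | ⟨cap, dem, hcap, hdem, hcut, hval⟩
  · exact hne hemb
  · -- positivity of the fractional demand: `Σ dem ρ > D Σ cap ρ ≥ 0`
    have hcapρ : 0 ≤ ∑ i, ∑ j, cap i j * E ((X (i : ℕ) - X (j : ℕ)) ^ 2) :=
      Finset.sum_nonneg fun i _ => Finset.sum_nonneg fun j _ => mul_nonneg (hcap i j) (hρ0 i j)
    have hpos : 0 < ∑ i, ∑ j, dem i j * E ((X (i : ℕ) - X (j : ℕ)) ^ 2) :=
      lt_of_le_of_lt (mul_nonneg hD.le hcapρ) hval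
    obtain ⟨S, hdemS, hineq⟩ := hround m cap dem hcap hdem E hEd hBoold hpos
    -- the rounding cut is at least as sparse as claimed, but every cut has `dem(δS) ≤ cap(δS)`
    have h3 := hcut S
    nlinarith [mul_lt_mul_of_pos_left hval hdemS,
      mul_le_mul_of_nonneg_right h3 hpos.le]


/-- The crux from the two stubs (registered composition). -/
theorem NoConstantApproxSparsestCut_holds_of_stubs : NoConstantApproxSparsestCut :=
  NoConstantApproxSparsestCut_of stub_sosOptimal stub_lasserreGaps

end Summit.PneNP.PneNP.Cruxes.NoConstantApproxSparsestCut.SosCaptureDuality
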